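import Summits.QuantumFields.YangMills.Theorems.BalabanUVNodesN15KingModelComplexLinkHolomorphy
import Mathlib.Analysis.Normed.Algebra.MatrixExponential
import Mathlib.Analysis.SpecialFunctions.Exponential
import HarnessLib
/-!
# BalabanUVNodes ∕ N15 — THE KING-MODEL RUNG (PART Ϛ-o): SEMIGROUP ∕ HEAT-KERNEL DOMINATION ON THE COMPLEX POLYDISC — for `t ≥ 0` and every two-sided link field with `‖U(b)‖, ‖V(b)‖ ≤ 1+ε`:
# `‖(e^{−tM_{U,V}})_{xy}‖_{op} ≤ (e^{−t·lapF K ((1+ε)c) (m²−2(d+1)cε)})(x,y)` — King's `A = 0` HEAT KERNEL at the shifted parameters majorises the complexified covariant heat kernel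
# ([DodziukMathai2006] Thm 1.5's semigroup domination, extended off the unitary slice; at `ε = 0` on unitary fields it is the classical statement `|e^{−t(−Δ_σ+m²)}(x,y)| ≤ e^{−t(−Δ+m²)}(x,y)`)
# (Track A, DAG node N15 = NE2; FAN-OUT v1.1 §N15 s3 «KING-MODEL RUNG … + what the curved case adds»; count-neutral)
HONEST FRAMING.  Count-neutral (cell `pub-ymgap`, seat `pub-ymgap-dag-n15-e` g43; `--supports stmt-QuantumFields-27247 --as helper` = K3ᴬ, KEY MAP v3).  One finite torus at fixed
spacing; King's `A = 0` model, FINE covariance layer only; nothing of Bałaban's (3.42) ∕ Thm 3.4 for `G(U)` asserted; nothing continuum ∕ ℝ⁴ ∕ OS ∕ Clay; NOT a node discharge.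
WHAT IS DECIDED.  [DodziukMathai2006] Thm 1.5 (§1): for a unitary connection `σ` on a graph, `|e^{−tΔ_σ}(x,y)| ≤ e^{−tΔ}(x,y)` (semigroup domination, Kato).  [Balaban1985BackgroundPropagators] Thm 3.4
p.400: the extended operators satisfy the same inequalities.  In King's model, with `M_{U,V} = D₀·1 − T_{U,V}` (PART Ϛ-a) on the polydisc `‖U(b)‖, ‖V(b)‖ ≤ 1+ε` (NO window inequality
needed for finite `t`), `T′ = kingHop K ((1+ε)c)`, `L′ = lapF K ((1+ε)c) (m²−2(d+1)cε) = D₀·1 − T′`: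
* §1 `exp_scalar_split` (`e^{−t(D₀·1 − T)} = e^{−tD₀}·e^{tT}`, matrices over `𝕜`, `Matrix.exp_add_of_commute` + `Matrix.exp_diagonal`), `rclike_exp_ofReal` (`e^{(r:𝕜)} = (e^r : 𝕜)`), `blk_smul_one_mul`;
* §2 ★★ `hasSum_blk_exp_smul_cxHop` (`(e^{tT_{U,V}})_{xy} = Σ_k (k!)⁻¹tᵏ(T_{U,V}^k)_{xy}` blockwise), `hasSum_exp_smul_kingHop_apply` (`(e^{tT′})(x,y) = Σ_k (k!)⁻¹tᵏ(T′^k)(x,y)`), ★★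
  `l2_opNorm_blk_exp_smul_cxHop_le` (`t ≥ 0 ⟹ ‖(e^{tT_{U,V}})_{xy}‖ ≤ (e^{tT′})(x,y)`, Ϛ-b `l2_opNorm_blk_cxHop_pow_le` term by term), `exp_smul_kingHop_apply_nonneg`;
* §3 ★★★ **`l2_opNorm_blk_exp_neg_cxLapF_le`** — THE HEAT-KERNEL DOMINATION on the polydisc: `‖(e^{−tM_{U,V}})_{xy}‖_{op} ≤ (e^{−tL′})(x,y)` for all `t ≥ 0`, `x, y`; ★★★
  **`l2_opNorm_blk_exp_neg_covLapF_le`** — at `ε = 0` on unitary fields: `‖(e^{−t(−cΔ_U+m²)})_{xy}‖_{op} ≤ (e^{−t(c(−Δ)+m²)})(x,y)` ([DM06] Thm 1.5 for King's torus, every unitary `U`); `exp_neg_lapF_apply_nonneg`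
  (King's heat kernel is entrywise `≥ 0`).
PRIOR TREE ART (by name): Ϛ-a (`cxHop`, `cxLapF`, `blk_smul'`, `blk_sum'`, `cxLapF_adjoint`), Ϛ-b (`l2_opNorm_blk_cxHop_pow_le`, `shifted_D0`, `shifted_weight_nonneg`, `unitary_mem_window`), Ϛ-e (`cxBlkCLM`),
Ͱ-g (`blk_mul'`), Ͱ-k (`kingHop`, `kingHop_pow_nonneg`, `lapF_eq_sub_kingHop`), Ͱ-l (`blk_one'`), Mathlib (`NormedSpace.exp`, `NormedSpace.exp_series_hasSum_exp'`, `Matrix.exp_add_of_commute`,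
`Matrix.exp_diagonal`, `Pi.coe_exp`, `NormedSpace.algebraMap_exp_comm`, `Real.exp_eq_exp_ℝ`, `Matrix.entryLinearMap`, `ContinuousLinearMap.hasSum`, `FiniteDimensional.complete`).  Dedup (rg at
filing): basename 0 files; needles `exp_neg_cxLapF|exp_smul_cxHop|exp_smul_kingHop|exp_neg_lapF_apply|exp_scalar_split\\b` checked.  Locators: [DodziukMathai2006] Thm 1.5 §1 (held
`paper:arxiv-math_0312450` p0004); [Balaban1985BackgroundPropagators] Thm 3.4 p.400, (3.23) p.394; [King1986] (4.4) p.670.  0 `sorry`, 0 `def`.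
-/

noncomputable section
open scoped BigOperators ComplexConjugate ComplexOrder Topology Matrix.Norms.L2Operator
open Finset Matrix Filter

namespace Summit.QuantumFields.YangMills.BalabanUVNodes.N15KingModelRung.Covariant

open Literature.MathematicalPhysics.QuantumFieldTheory.LatticeDiamagneticInequality (Hopping blk)
open Literature.MathematicalPhysics.QuantumFieldTheory.Balaban1983to89.B5Prop11Plancherel (Tor unitVec)
open Literature.MathematicalPhysics.QuantumFieldTheory.King1986.Torus (lapF)

variable {d : ℕ} (K : Fin (d + 1) → ℕ) [hK : ∀ μ, NeZero (K μ)]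
variable {𝕜 : Type*} [RCLike 𝕜] {n : Type*} [Fintype n] [DecidableEq n] {c m2 ε : ℝ}

/-! ## §1 Splitting off the scalar part -/

omit hK in
/-- `e^{(r : 𝕜)} = (e^r : 𝕜)` for a real `r`. [folklore] -/
theorem rclike_exp_ofReal (r : ℝ) : NormedSpace.exp ((r : ℝ) : 𝕜) = ((Real.exp r : ℝ) : 𝕜) := by
  rw [Real.exp_eq_exp_ℝ, ← RCLike.algebraMap_eq_ofReal]
  exact (NormedSpace.algebraMap_exp_comm (𝔸 := 𝕜) r).symm

/-- THE SCALAR SPLITTING: for any matrix `T` over `𝕜` (index `ι`) and reals `t, D₀`,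
`exp (−((t:𝕜) • (diagonal (fun _ => (D₀:𝕜)) − T))) = ((e^{−tD₀} : ℝ) : 𝕜) • exp ((t:𝕜) • T)` (the scalar matrix commutes with everything). [folklore] -/
theorem exp_scalar_split {ι : Type*} [Fintype ι] [DecidableEq ι] (T : Matrix ι ι 𝕜) (t D0 : ℝ) :
    NormedSpace.exp (-(((t : ℝ) : 𝕜) • (diagonal (fun _ : ι => ((D0 : ℝ) : 𝕜)) - T)))
      = (((Real.exp (-(t * D0)) : ℝ) : 𝕜)) • NormedSpace.exp ((((t : ℝ) : 𝕜)) • T) := by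
  have hsplit : -(((t : ℝ) : 𝕜) • (diagonal (fun _ : ι => ((D0 : ℝ) : 𝕜)) - T))
      = diagonal (fun _ : ι => ((-(t * D0) : ℝ) : 𝕜)) + (((t : ℝ) : 𝕜)) • T := by
    rw [smul_sub, neg_sub, sub_eq_add_neg, add_comm]
    congr 1
    ext i j
    simp only [Matrix.neg_apply, Matrix.smul_apply, diagonal_apply, smul_eq_mul, mul_ite, mul_zero]
    split_ifs
    · push_cast; ring
    · simp
  have hcomm : Commute (diagonal (fun _ : ι => ((-(t * D0) : ℝ) : 𝕜))) ((((t : ℝ) : 𝕜)) • T) := by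
    rw [Commute, SemiconjBy]
    ext i j
    simp only [Matrix.mul_apply, diagonal_apply, Matrix.smul_apply, smul_eq_mul, ite_mul, zero_mul, mul_ite, mul_zero,
      Finset.sum_ite_eq, Finset.sum_ite_eq', Finset.mem_univ, if_true]
    ring
  rw [hsplit, Matrix.exp_add_of_commute _ _ hcomm, Matrix.exp_diagonal]
  have hdiag : diagonal (NormedSpace.exp (fun _ : ι => ((-(t * D0) : ℝ) : 𝕜))) = (((Real.exp (-(t * D0)) : ℝ) : 𝕜)) • (1 : Matrix ι ι 𝕜) := by
    ext i j
    rw [diagonal_apply, Matrix.smul_apply, Matrix.one_apply, smul_eq_mul, mul_ite, mul_one, mul_zero]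
    split_ifs
    · rw [Pi.coe_exp, rclike_exp_ofReal]
    · rfl
  rw [hdiag, smul_mul_assoc, Matrix.one_mul]

/-! ## §2 The exponential series of the hopping matrices, blockwise -/

/-- ★★ THE BLOCKS OF `e^{tT_{U,V}}` AS A SERIES: `(e^{tT_{U,V}})_{xy} = Σ_k (k!)⁻¹·tᵏ·(T_{U,V}^k)_{xy}` in `Matrix n n 𝕜`. [folklore] -/
theorem hasSum_blk_exp_smul_cxHop (c t : ℝ) (U V : Tor K × Fin (d + 1) → Matrix n n 𝕜) (x y : Tor K) :
    HasSum (fun k : ℕ => (((k.factorial : 𝕜))⁻¹ * (((t : ℝ) : 𝕜)) ^ k) • blk (cxHop K c U V ^ k) x y)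
      (blk (NormedSpace.exp ((((t : ℝ) : 𝕜)) • cxHop K c U V)) x y) := by
  haveI : CompleteSpace (Matrix (Tor K × n) (Tor K × n) 𝕜) := FiniteDimensional.complete 𝕜 _
  have h := (NormedSpace.exp_series_hasSum_exp' (𝕂 := 𝕜) ((((t : ℝ) : 𝕜)) • cxHop K c U V)).mapL (cxBlkCLM K 𝕜 n x y)
  refine h.congr_fun fun k => ?_
  simp only [cxBlkCLM_apply, smul_pow, blk_smul', smul_smul]

/-- THE ENTRIES OF `e^{tT′}` AS A SERIES (King's real hopping matrix): `(e^{tT′})(x,y) = Σ_k (k!)⁻¹·tᵏ·(T′^k)(x,y)`. [folklore] -/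
theorem hasSum_exp_smul_kingHop_apply (c' t : ℝ) (x y : Tor K) :
    HasSum (fun k : ℕ => ((k.factorial : ℝ))⁻¹ * t ^ k * (kingHop K c' ^ k) x y) ((NormedSpace.exp (t • kingHop K c')) x y) := by
  haveI : CompleteSpace (Matrix (Tor K) (Tor K) ℝ) := FiniteDimensional.complete ℝ _
  have h := (NormedSpace.exp_series_hasSum_exp' (𝕂 := ℝ) (t • kingHop K c')).mapL ((Matrix.entryLinearMap ℝ ℝ x y).toContinuousLinearMap)
  refine h.congr_fun fun k => ?_
  simp only [LinearMap.coe_toContinuousLinearMap', Matrix.entryLinearMap_apply, smul_pow, Matrix.smul_apply, smul_eq_mul, mul_assoc]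

/-- The terms of King's series are non-negative for `t ≥ 0`, `c′ ≥ 0`. [folklore] -/
theorem exp_series_kingHop_term_nonneg {c' t : ℝ} (hc' : 0 ≤ c') (ht : 0 ≤ t) (k : ℕ) (x y : Tor K) :
    0 ≤ ((k.factorial : ℝ))⁻¹ * t ^ k * (kingHop K c' ^ k) x y :=
  mul_nonneg (mul_nonneg (inv_nonneg.mpr (Nat.cast_nonneg _)) (pow_nonneg ht _)) (kingHop_pow_nonneg K hc' k x y)

/-- `(e^{tT′})(x,y) ≥ 0` for `t ≥ 0`, `c′ ≥ 0`. [folklore] -/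
theorem exp_smul_kingHop_apply_nonneg {c' t : ℝ} (hc' : 0 ≤ c') (ht : 0 ≤ t) (x y : Tor K) : 0 ≤ (NormedSpace.exp (t • kingHop K c')) x y :=
  (hasSum_exp_smul_kingHop_apply K c' t x y).nonneg (fun k => exp_series_kingHop_term_nonneg K hc' ht k x y)

/-- ★★ **DOMINATION OF THE HOPPING SEMIGROUP**: `t ≥ 0`, `c ≥ 0`, `‖U(b)‖, ‖V(b)‖ ≤ 1+ε` ⟹ `‖(e^{tT_{U,V}})_{xy}‖_{op} ≤ (e^{tT′})(x,y)`, `T′ = kingHop K ((1+ε)c)` (term by term, Ϛ-b).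
[cite: DodziukMathai2006, Thm 1.5 §1; Balaban1985BackgroundPropagators, Thm 3.4 p.400] -/
theorem l2_opNorm_blk_exp_smul_cxHop_le (hc : 0 ≤ c) {t : ℝ} (ht : 0 ≤ t) {U V : Tor K × Fin (d + 1) → Matrix n n 𝕜}
    (hU : ∀ b, ‖U b‖ ≤ 1 + ε) (hV : ∀ b, ‖V b‖ ≤ 1 + ε) (x y : Tor K) :
    ‖blk (NormedSpace.exp ((((t : ℝ) : 𝕜)) • cxHop K c U V)) x y‖ ≤ (NormedSpace.exp (t • kingHop K ((1 + ε) * c))) x y := by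
  haveI : CompleteSpace (Matrix n n 𝕜) := FiniteDimensional.complete 𝕜 _
  have hW := hasSum_blk_exp_smul_cxHop K c t U V x y
  have hF := hasSum_exp_smul_kingHop_apply K ((1 + ε) * c) t x y
  have hterm : ∀ k : ℕ, ‖(((k.factorial : 𝕜))⁻¹ * (((t : ℝ) : 𝕜)) ^ k) • blk (cxHop K c U V ^ k) x y‖
      ≤ ((k.factorial : ℝ))⁻¹ * t ^ k * (kingHop K ((1 + ε) * c) ^ k) x y := fun k => by
    rw [norm_smul, norm_mul, norm_inv, RCLike.norm_natCast, norm_pow, RCLike.norm_ofReal, abs_of_nonneg ht]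
    exact mul_le_mul_of_nonneg_left (l2_opNorm_blk_cxHop_pow_le K hc hU hV k x y)
      (mul_nonneg (inv_nonneg.mpr (Nat.cast_nonneg _)) (pow_nonneg ht _))
  have hnorm : Summable (fun k : ℕ => ‖(((k.factorial : 𝕜))⁻¹ * (((t : ℝ) : 𝕜)) ^ k) • blk (cxHop K c U V ^ k) x y‖) :=
    Summable.of_nonneg_of_le (fun k => norm_nonneg _) hterm hF.summable
  rw [← hW.tsum_eq]
  exact (norm_tsum_le_tsum_norm hnorm).trans (hasSum_le hterm hnorm.hasSum hF)

/-! ## §3 Heat-kernel domination -/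

omit [Fintype n] in
/-- `M_{U,V} = diagonal(D₀) − T_{U,V}` (unfolding, for the splitting). [folklore] -/
theorem cxLapF_eq_diagonal_sub (c m2 : ℝ) (U V : Tor K × Fin (d + 1) → Matrix n n 𝕜) :
    cxLapF K c m2 U V = diagonal (fun _ : Tor K × n => (((m2 + 2 * ((d : ℝ) + 1) * c : ℝ) : 𝕜))) - cxHop K c U V := rfl

omit hK in
/-- King's `lapF` at the shifted parameters as `diagonal(D₀) − T′` over `ℝ` (same `D₀`, Ϛ-b `shifted_D0`). [cite: King1986, (4.4) p.670] -/
theorem lapF_shifted_eq_diagonal_sub (c m2 ε : ℝ) :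
    lapF K ((1 + ε) * c) (m2 - 2 * ((d : ℝ) + 1) * c * ε)
      = diagonal (fun _ : Tor K => m2 + 2 * ((d : ℝ) + 1) * c) - kingHop K ((1 + ε) * c) := by
  rw [lapF_eq_sub_kingHop, shifted_D0]
  congr 1
  ext x y
  simp only [Matrix.smul_apply, Matrix.one_apply, diagonal_apply, smul_eq_mul, mul_ite, mul_one, mul_zero]

/-- ★★★ **HEAT-KERNEL DOMINATION ON THE COMPLEX POLYDISC**: for `c ≥ 0`, `ε ≥ 0`, `t ≥ 0` and every two-sided field with `‖U(b)‖, ‖V(b)‖ ≤ 1+ε`, all `x, y`: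
`‖(e^{−tM_{U,V}})_{xy}‖_{op} ≤ (e^{−t·lapF K ((1+ε)c) (m²−2(d+1)cε)})(x,y)` — King's `A = 0` heat kernel at the shifted parameters majorises the complexified covariant one (no window
inequality is needed at finite `t`; the scalar factor `e^{−tD₀}` is common, the hopping semigroups are compared term by term).
[cite: DodziukMathai2006, Thm 1.5 §1; Balaban1985BackgroundPropagators, Thm 3.4 p.400, (3.23) p.394; King1986, (4.4) p.670] -/
theorem l2_opNorm_blk_exp_neg_cxLapF_le (hc : 0 ≤ c) {t : ℝ} (ht : 0 ≤ t) {U V : Tor K × Fin (d + 1) → Matrix n n 𝕜}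
    (hU : ∀ b, ‖U b‖ ≤ 1 + ε) (hV : ∀ b, ‖V b‖ ≤ 1 + ε) (x y : Tor K) :
    ‖blk (NormedSpace.exp (-((((t : ℝ) : 𝕜)) • cxLapF K c m2 U V))) x y‖
      ≤ (NormedSpace.exp (-(t • lapF K ((1 + ε) * c) (m2 - 2 * ((d : ℝ) + 1) * c * ε)))) x y := by
  -- complex side: split off `e^{−tD₀}`
  rw [cxLapF_eq_diagonal_sub, exp_scalar_split, blk_smul', norm_smul, RCLike.norm_ofReal, abs_of_pos (Real.exp_pos _)]
  -- real side: the same splitting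
  have hreal : NormedSpace.exp (-(t • lapF K ((1 + ε) * c) (m2 - 2 * ((d : ℝ) + 1) * c * ε)))
      = (Real.exp (-(t * (m2 + 2 * ((d : ℝ) + 1) * c)))) • NormedSpace.exp (t • kingHop K ((1 + ε) * c)) := by
    have h := exp_scalar_split (𝕜 := ℝ) (kingHop K ((1 + ε) * c)) t (m2 + 2 * ((d : ℝ) + 1) * c)
    simp only [RCLike.ofReal_real_eq_id, id_eq] at h
    rw [lapF_shifted_eq_diagonal_sub]
    simpa only [RCLike.ofReal_real_eq_id, id_eq] using h
  rw [hreal, Matrix.smul_apply, smul_eq_mul]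
  exact mul_le_mul_of_nonneg_left (l2_opNorm_blk_exp_smul_cxHop_le K hc ht hU hV x y) (Real.exp_pos _).le

/-- ★ KING's HEAT KERNEL IS ENTRYWISE NON-NEGATIVE: `(e^{−t·lapF K c′ m′²})(x,y) ≥ 0` for `t ≥ 0`, `c′ ≥ 0` (any `m′²`). [cite: King1986, (4.4) p.670] -/
theorem exp_neg_lapF_shifted_apply_nonneg (hc : 0 ≤ c) (hε : 0 ≤ ε) {t : ℝ} (ht : 0 ≤ t) (x y : Tor K) :
    0 ≤ (NormedSpace.exp (-(t • lapF K ((1 + ε) * c) (m2 - 2 * ((d : ℝ) + 1) * c * ε)))) x y := by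
  have h := exp_scalar_split (𝕜 := ℝ) (kingHop K ((1 + ε) * c)) t (m2 + 2 * ((d : ℝ) + 1) * c)
  simp only [RCLike.ofReal_real_eq_id, id_eq] at h
  rw [lapF_shifted_eq_diagonal_sub, h, Matrix.smul_apply, smul_eq_mul]
  exact mul_nonneg (Real.exp_pos _).le (exp_smul_kingHop_apply_nonneg K (shifted_weight_nonneg hc hε) ht x y)

/-- ★★★ **[DODZIUK–MATHAI] THM 1.5 FOR KING's TORUS AT EVERY UNITARY LINK FIELD**: for `c ≥ 0`, `t ≥ 0`, unitary `U`, all `x, y`: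
`‖(e^{−t(−cΔ_U+m²)})_{xy}‖_{op} ≤ (e^{−t(c(−Δ)+m²)})(x,y)` — the covariant heat kernel is dominated blockwise by King's `A = 0` heat kernel (the `ε = 0` case of the polydisc statement on the
adjoint slice `V = Uᴴ`). [cite: DodziukMathai2006, Thm 1.5 §1; King1986, (4.4) p.670; Balaban1985BackgroundPropagators, (3.23) p.394] -/
theorem l2_opNorm_blk_exp_neg_covLapF_le (hc : 0 ≤ c) (m2 : ℝ) {t : ℝ} (ht : 0 ≤ t) {U : Tor K × Fin (d + 1) → Matrix n n 𝕜}
    (hU : ∀ b, U b ∈ Matrix.unitaryGroup n 𝕜) (x y : Tor K) :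
    ‖blk (NormedSpace.exp (-((((t : ℝ) : 𝕜)) • covLapF K c m2 U))) x y‖ ≤ (NormedSpace.exp (-(t • lapF K c m2))) x y := by
  have h := l2_opNorm_blk_exp_neg_cxLapF_le K (m2 := m2) (ε := 0) hc ht (unitary_mem_window K hU).1 (unitary_mem_window K hU).2 x y
  rwa [cxLapF_adjoint, add_zero, one_mul, mul_zero, sub_zero] at h

end Summit.QuantumFields.YangMills.BalabanUVNodes.N15KingModelRung.Covariant

end
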